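import Summits.BirchSwinnertonDyer.BirchSwinnertonDyer.Theses.EisensteinPrimes
import Literature.NumberTheory.EllipticCurves.SteinWuthrich2013.SplitMultCanonicalHolds
import Literature.NumberTheory.EllipticCurves.SteinWuthrich2013.NonsplitMultCanonicalHolds
import HarnessLib

/-!
# Route `EisensteinPrimes` (rung K5): the support item `PublishedInputs` (item 19037) from EIGHTEEN named facts —
# its two Stein–Wuthrich «canonical height EXISTS» conjuncts are tree theorems

Cell `bsd-eis` (host `run/shared/lean/pub/bsd-eis/`), seat `bsd-eis-lam-a` g21 (`--supports` stmt-BirchSwinnertonDyer-19033 as a HELPER;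
no claim, closes nothing by itself). The route's support item `EisensteinPrimes.PublishedInputs` (stmt-BirchSwinnertonDyer-19037) is the
conjunction of TWENTY cite-tagged named facts and is stub 1 (`stub_publishedInputs`, resp. conjunct 1 of the VARIANT-N cite stub) of
every registered X2 skeleton of the cell (crux 3 `MazurMCOnCellB` twistback v12; crux 4 `BSDpOnCellC`). Two of its conjuncts —
18 `SteinWuthrich2013.exists_isSplitMultCanonical` and 19 `SteinWuthrich2013.exists_isMultCanonical` (existence of the Stein–Wuthrich
§4.2 canonical `ℓ`-adic height datum in the split / non-split multiplicative case) — are TREE THEOREMS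
(`SteinWuthrich2013.exists_isSplitMultCanonical_holds`, `…exists_isMultCanonical_holds`; cell bsd-eis k5-c4; noticed for the
twistback toucher by bsd-line-x2-p1-w5 g9, STATUS 14:07:04Z). This file records the by-name consequence:

* `publishedInputsTail_of_seven` — the tail child `PublishedInputsTail` (conjuncts 9, 10, 12, 13, 16–20) from its SEVEN other conjuncts;
* **`publishedInputs_of_eighteen`** — `PublishedInputs` from the conjunction of its EIGHTEEN other conjuncts (parent's order, 18 and 19
  omitted), so a VARIANT-N cite stub may carry 18 names instead of 20 (item 19037 itself still closes only when all twenty have `_holds`).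

Pure reassembly; the eighteen facts stay hypotheses; nothing about BSD / Mazur's main conjecture is asserted; 0 cells / labels / tiers move.
[cite: SteinWuthrich2013, §4.2 and Thm. 6.1] [cite: GreenbergVatsal2000, Thm. 1.3] [cite: KellerYin2024, Thm. A]
-/

set_option autoImplicit false
set_option linter.dupNamespace false

namespace Summit.BirchSwinnertonDyer.BirchSwinnertonDyer.Theorems.EisensteinPrimesPublishedInputsOfEighteen

open Summit.BirchSwinnertonDyer.BirchSwinnertonDyer.Theses.EisensteinPrimes
open Literature.NumberTheory.EllipticCurves

/-- **The tail child `PublishedInputsTail` from seven named facts** (conjuncts 9, 10, 12, 13, 16, 17, 20 of `PublishedInputs`): the two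
«canonical height exists» conjuncts 18/19 are supplied by the tree theorems `SteinWuthrich2013.exists_isSplitMultCanonical_holds` /
`SteinWuthrich2013.exists_isMultCanonical_holds`. Pure reassembly. [cite: SteinWuthrich2013, §4.2 and Thm. 6.1] -/
theorem publishedInputsTail_of_seven
    (h9 : ∀ (N : ℕ) [NeZero N] (W : WeierstrassCurve ℚ) (K : Type) [Field K] [NumberField K], gross_zagier N W K)
    (h10 : ∀ (N : ℕ) [NeZero N] (W : WeierstrassCurve ℚ) (K : Type) [Field K] [NumberField K], kolyvagin N W K)
    (h12 : Schneider1985_order_charGenerator_odd) (h13 : perrinRiou_rankOne_leadingTerms_odd)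
    (h16 : SteinWuthrich2013.thm61_splitMultiplicative) (h17 : SteinWuthrich2013.thm61_nonsplitMultiplicative)
    (h20 : ∀ (W : WeierstrassCurve ℚ) [W.IsElliptic] [W.IsGloballyMinimal] (p : ℕ) [Fact p.Prime], greenberg_stevens (W := W) (p := p)) :
    PublishedInputsTail :=
  ⟨h9, h10, h12, h13, h16, h17, SteinWuthrich2013.exists_isSplitMultCanonical_holds,
    SteinWuthrich2013.exists_isMultCanonical_holds, h20⟩

/-- **`PublishedInputs` (item stmt-BirchSwinnertonDyer-19037) FROM EIGHTEEN NAMED FACTS** — the conjunction of its conjuncts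
1–17 and 20 in the parent's order (CGLS 2022 Thm. 5.1.1 · Cassels' isogeny invariance · GV 2000 Thm. 1.3 · Greenberg 1999 Thm. 4.1 ·
modular parametrisation · newform · Hoffstein–Luo · Gross–Zagier I.7.3 · Gross–Zagier/K · Kolyvagin/K · rank = analytic rank ≤ 1 ·
Schneider 1985 · Perrin-Riou rank-one leading terms · GV (λ, μ) multiplicative · Wuthrich 2014 Thm. 16 · Stein–Wuthrich Thm. 6.1 split ·
non-split · Greenberg–Stevens) implies `PublishedInputs`; conjuncts 18/19 (Stein–Wuthrich canonical height data EXIST, split /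
non-split) are the tree theorems `SteinWuthrich2013.exists_isSplitMultCanonical_holds` / `…exists_isMultCanonical_holds`. For a
VARIANT-N toucher of an X2 skeleton: `stub_printInputs : <this 18-conjunct text> ∧ …` and `publishedInputs_closed :=
publishedInputs_of_eighteen stub_printInputs.1` read «18 names, not 20». Pure reassembly; nothing asserted.
[cite: SteinWuthrich2013, §4.2 and Thm. 6.1] [cite: GreenbergVatsal2000, Thm. 1.3] [cite: KellerYin2024, Thm. A] -/
theorem publishedInputs_of_eighteen
    (h : CastellaGrossiLeeSkinner2022.thm511_anticyclotomicControl_of_torsionFree ∧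
      WeierstrassCurve.bsdRHS_eq_of_isIsogenous ∧
      GreenbergVatsal2000.thm13_charIdeal_eq_of_gvPar ∧
      greenberg_charValue_rankZero ∧
      ModularForms.nonempty_modularParametrizationData ∧
      ModularForms.exists_isNewformOf ∧
      HoffsteinLuo1997_exists_twist_L_one_ne_zero ∧
      GrossZagier1986_thm_I_7_3 ∧
      (∀ (N : ℕ) [NeZero N] (W : WeierstrassCurve ℚ) (K : Type) [Field K] [NumberField K], gross_zagier N W K) ∧
      (∀ (N : ℕ) [NeZero N] (W : WeierstrassCurve ℚ) (K : Type) [Field K] [NumberField K], kolyvagin N W K) ∧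
      rank_eq_analyticRank_of_analyticRank_le_one ∧
      Schneider1985_order_charGenerator_odd ∧
      perrinRiou_rankOne_leadingTerms_odd ∧
      GreenbergVatsal2000.lambdaMu_multiplicative_of_gvPar ∧
      Wuthrich2014.thm16_charIdeal_dvd_multiplicative_of_reducible ∧
      SteinWuthrich2013.thm61_splitMultiplicative ∧
      SteinWuthrich2013.thm61_nonsplitMultiplicative ∧
      (∀ (W : WeierstrassCurve ℚ) [W.IsElliptic] [W.IsGloballyMinimal] (p : ℕ) [Fact p.Prime], greenberg_stevens (W := W) (p := p))) :
    PublishedInputs := by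
  obtain ⟨h1, h2, h3, h4, h5, h6, h7, h8, h9, h10, h11, h12, h13, h14, h15, h16, h17, h20⟩ := h
  exact ⟨h1, h2, h3, h4, h5, h6, h7, h8, h9, h10, h11, h12, h13, h14, h15, h16, h17,
    SteinWuthrich2013.exists_isSplitMultCanonical_holds, SteinWuthrich2013.exists_isMultCanonical_holds, h20⟩

end Summit.BirchSwinnertonDyer.BirchSwinnertonDyer.Theorems.EisensteinPrimesPublishedInputsOfEighteen
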